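import Literature.Analysis.FluidPDE.Axisymmetric
import HarnessLib

/-!
# Chen–Hou: finite-time blow-up of smooth axisymmetric Euler flows in the periodic cylinder
(the result *as printed*, and its reduction to `Literature.Analysis.FluidPDE.chen_hou_blowup`)

Topic `Literature/Analysis/FluidPDE`. Decomposition/faithfulness file for the named fact
`Literature.Analysis.FluidPDE.chen_hou_blowup` (`Axisymmetric.lean`, statement **ns.S29 (ii)**). Sources (all held in
the literature store; page numbers `p.` below are those of the held text renderings):

* `[arXiv221007191]` J. Chen, T. Y. Hou, *Stable nearly self-similar blowup of the 2D Boussinesq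
  and 3D Euler equations with smooth data I: Analysis*, arXiv:2210.07191 — §1, second theorem
  ("Theorem 2", p. 3: the 3D Euler statement; the first theorem is the 2D Boussinesq one), made
  precise as "Theorem 4" (`thm:euler`) in §6.1 (p. 54); setup §6 (p. 53); proof concluded in
  §6.5 (p. 66).
* `[ChenHou2023RigorousNumerics]` Part II: *Rigorous numerics*, arXiv:2305.05660 — verifies, with
  computer assistance (interval arithmetic, space-time numerical solutions with rigorous error
  control), that the stability constants of Part I satisfy the inequalities of the stability
  lemma; this completes the proof (Part II, abstract and §1, "Theorem 2").
* `[ChenHou2021Boundary]` J. Chen, T. Y. Hou, *Finite time blowup of 2D Boussinesq and 3D Euler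
  equations with `C^{1,α}` velocity and boundary*, Comm. Math. Phys. 383 (2021),
  arXiv:1910.00173 — §8.6.2 and the end of §9 (p. 53 of the held text): the passage from
  nonlinear stability in rescaled variables to finite-time blow-up, invoked verbatim by Part I,
  p. 66 ("follows the argument in [chen2019finite2]").
* `[ChenHou2025]` J. Chen, T. Y. Hou, *Singularity formation in 3D Euler equations with smooth
  initial data and boundary*, PNAS 122 (2025) — the published summary, Theorem 1.

## The printed statement (Part I, §1 "Theorem 2", p. 3; §6, p. 53)

"Consider the 3D axisymmetric Euler equations in the cylinder `r, z ∈ [0, 1] × 𝕋`. Let `u^θ` and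
`ω^θ` be the angular velocity and angular vorticity, respectively. The solution of the 3D Euler
equations (1.1)–(1.3) develops a nearly self-similar blowup … in finite time for some smooth
initial data `ω₀^θ`, `u₀^θ` supported away from the symmetry axis `r = 0`. The initial velocity
field has finite energy, `u₀^θ` and `ω₀^θ` are odd [sic; see below] and periodic in `z`. The
blowup is stable …". Here (§6, p. 53) `𝕋 = ℝ/(2ℤ)` ("`φ̃` is `2`-periodic in `z`"; first period
`D₁ = {(r, z) : r ∈ [0, 1], |z| ≤ 1}`), the equations are the axisymmetric Euler equations in
the `(u^θ, ω^θ, φ̃)` (velocity–vorticity–stream) form with the **no-flow condition**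
`φ̃(1, z) = 0` on the solid boundary `r = 1`, i.e. `u^r = −∂_z φ̃ = 0` on `{r = 1}`, and
`e_r = (x₁, x₂, 0)/r`, `e_θ = (x₂, −x₁, 0)/r` (the opposite orientation of `Literature.Analysis.FluidPDE.eTheta`;
only `|ω^θ|` and the vanishing of `u^θ`, `ω^θ` enter below, so the sign is immaterial).

## Architecture of the printed proof (for the record; sizes refer to a Lean formalisation)

1. (§6, p. 53) Variables `θ̃ = (r u^θ)²`, `ω̃ = ω^θ / r` turn axisymmetric Euler near the wall into
   a perturbation of 2D Boussinesq; `u^θ ≥ 0` near the blow-up point, so `u^θ = θ̃^{1/2}/r` is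
   recovered (CMP 2021, p. 53).
2. (§6.1) Dynamic rescaling centred at `(r, z) = (1, 0)` with factors `C_l, C_θ, C_ω`,
   `t(τ) = ∫₀^τ C_ω`; rescaled system (6.12) = Boussinesq dynamic-rescaling system + `O(C_l)` terms.
3. (§7 of Part I; Part II App. C) A numerically computed approximate steady state `(ω̄, θ̄)`
   (piecewise polynomials on an adaptive mesh plus a semi-analytic far field), localised by a
   cutoff `χ_ν` (§6.4.2). **This profile is data (spline coefficients shipped with Part II), so the
   nonlinear-stability theorem "Theorem 4" is not statable as a stand-alone Lean `Prop` without
   importing that data** — the reason the decomposition below stops at the physical statement.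
4. (Part I §§2–5 + Part II) Linear stability of `L₀ = L − K` (`K` of rank `< 50`) in a weighted
   `L^∞ ∩ C^{1/2}` energy `E₄`; the finite-rank part by rigorously controlled space-time numerical
   solutions; all constants certified by interval arithmetic. Size: XL (computer-assisted).
5. ("Theorem 4", p. 54; §6.5, p. 66) Nonlinear stability: `E₄ < E_* = 5·10⁻⁶` propagates for all
   rescaled times under a bootstrap on the support size `C_l(τ)(1 + S(τ))`; moreover
   `c̄_ω + c_ω < −1/2`, `c̄_l > 2`, and `C_l(τ)(1 + S(τ)) ≤ C(S(0)) C_l(0)` keeps the support inside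
   the cylinder, away from the axis and from `z = ±1`.
6. (CMP 2021 §8.6.2, p. 41, and p. 53) `T* = t(∞) = ∫₀^∞ C_ω dτ < ∞`; by the Beale–Kato–Majda
   criterion the solution stays smooth on `[0, T*)` and `‖ω‖_{L^∞}` blows up at `T*`; finite
   energy in `D₁`. Background used but not proved there: local well-posedness of smooth
   axisymmetric Euler flows in the cylinder with the no-flow condition and the BKM criterion in a
   domain with boundary (Kato–Lai 1984; Ferrari 1993) — not in Mathlib, sources not held.

## What this file vendors

* `Literature.NS.angularVorticity u x = ⟪curl u x, e_θ x⟫` (`ω^θ`, junk `0` on the axis where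
  `eTheta = 0`), with `|ω^θ| ≤ ‖ω‖` (`abs_angularVorticity_le_norm_curl`, via `‖e_θ‖ ≤ 1`);
* `Literature.NS.chenHouPeriodCell = D₁ = {r ≤ 1, |z| ≤ 1}` (one period of the closed cylinder);
* the named fact `Literature.Analysis.FluidPDE.ChenHou2022_axisymmetricEulerBlowup` — the theorem as printed, in the
  velocity–pressure rendering already reviewed for `chen_hou_blowup` (classical Euler solution in
  `Fluid.unitCylinder` with slip field `Fluid.eR`, `Fluid.IsClassicalEulerOnDomain`), but with the
  printed specifics that `chen_hou_blowup` elides: axial period **`2`**, `u₀^θ` and `ω₀^θ`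
  **supported away from the axis**, **finite energy** on a period cell, and blow-up of the
  **angular** vorticity `ω^θ`;
* the proved reduction `Literature.NS.chen_hou_blowup_of_chenHou2022 : ChenHou2022_… → chen_hou_blowup`
  (`|ω^θ| ≤ ‖ω‖`, `L := 2`).

## Faithfulness notes

* Blow-up is rendered in the weakest printed reading, `limsup_{t ↑ T} ‖ω^θ(t)‖_{L^∞({r<1})} = ∞`
  as `∀ M, ∃ᶠ t in 𝓝[<] T, ∃ x ∈ {r < 1}, M < |ω^θ(t, x)|` (same shape as the accepted
  `NS.VorticityBlowsUpOnAt`). It is implied by what is printed: in rescaled variables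
  `‖ω(τ) − ω̄₀‖_∞ < 200 E_*` for all `τ` ("Theorem 4") with `ω̄₀ ≠ 0` fixed and
  `ω^θ(t(τ)) / r = C_ω(τ)⁻¹ ω(τ)` (6.9), while `∫₀^∞ C_ω = T < ∞` forces `liminf C_ω = 0`; the
  support stays in `r ≥ 1 − C_l S ≥ 1/2`, and `ω^θ(t, ·)` is continuous up to the wall, so large
  values are attained at interior points `r < 1`.
* Parity ("`u₀^θ` and `ω₀^θ` are odd in `z`") is **not** vendored: in the precise construction
  (§6, p. 53: "`u^θ` can be uniquely determined by `(u^θ)²`" for `u^θ ≥ 0`; §6.4.2: `θ̄₀ = χ_ν(1 + θ̄) ≳ 1`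
  near the origin) `θ̃ = (r u^θ)²` is even in `z` and `ω^θ` odd; omitting a conclusion from an
  existential statement only weakens it, so nothing stronger than the source is asserted.
* "Nearly self-similar" and "stable" (closeness to the numerical profile in the weighted norms of
  (2.41)) are descriptive of the numerical profile and are not formalised (see item 3 above).
* As in `chen_hou_blowup`: the datum is a smooth field on all of `ℝ³` (the printed data are
  `C^∞` on the closed cylinder, `u^θ₀, ω^θ₀` compactly supported near `(r, z) = (1, 0)` away from
  the axis, and `(u^r₀, u^z₀)` come from the elliptic problem (6.2)–(6.3), smooth up to the wall;
  smooth axisymmetric periodic extension across `{r = 1}` is then free), the pressure is only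
  required `C¹` up to the boundary and is not required periodic (the closed infinite cylinder is
  convex, so the curl-free field `−(∂ₜu + (u·∇)u)` is a gradient there).
* Locator remark for `chen_hou_blowup`'s docstring ("Theorem 1.1"): in the held text of Part I
  the 3D Euler result is the *second* theorem of §1; its precise form is `thm:euler` in §6.1;
  the published summary `[ChenHou2025]` states it as Theorem 1. The mathematics of
  `chen_hou_blowup` is faithful (it is the corollary proved below).

Mathlib has no Euler/axisymmetry/blow-up notions (`lean search 'angularVorticity|xisymm|swirl'`:
only the `Literature` prelude `AxisymmetricEuler`). Used: `abs_real_inner_le_norm`,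
`EuclideanSpace.norm_eq`, `Filter.Frequently.mono`.
-/

noncomputable section

open MeasureTheory Set Function Filter Topology TopologicalSpace WithLp
open scoped ContDiff NNReal ENNReal InnerProductSpace RealInnerProductSpace

namespace Literature.Analysis.FluidPDE

/-- Local notation for physical space `ℝ³ = EuclideanSpace ℝ (Fin 3)`. -/
local notation "ℝ³" => EuclideanSpace ℝ (Fin 3)

/-! ### The angular vorticity `ω^θ` and the period cell -/

/-- The numerator `(−x₁, x₀, 0)` of the angular frame vector has norm `r`:
`‖(−x₁, x₀, 0)‖ = √(x₀² + x₁²) = cylRadius x`. [folklore] -/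
theorem norm_toLp_angular (x : ℝ³) : ‖toLp 2 ![-x 1, x 0, (0 : ℝ)]‖ = FluidPDE.cylRadius x := by
  rw [EuclideanSpace.norm_eq, FluidPDE.cylRadius]
  congr 1
  simp [Fin.sum_univ_three]
  ring

/-- The angular unit vector has norm at most one: `‖e_θ x‖ = 1` off the axis and `e_θ x = 0`
(junk value) on the axis (KNSS 2009, (1.5): `e_θ` is a unit vector for `r ≠ 0`). [folklore] -/
theorem norm_eTheta_le_one (x : ℝ³) : ‖FluidPDE.eTheta x‖ ≤ 1 := by
  rw [FluidPDE.eTheta, norm_smul, norm_toLp_angular, norm_inv, Real.norm_eq_abs,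
    abs_of_nonneg (FluidPDE.cylRadius_nonneg x)]
  by_cases hr : FluidPDE.cylRadius x = 0
  · simp [hr]
  · rw [inv_mul_cancel₀ hr]

/-- Off the axis the angular frame vector is a unit vector: `‖e_θ x‖ = 1` for `r ≠ 0`
(KNSS 2009, (1.5)). [folklore] -/
theorem norm_eTheta_eq_one {x : ℝ³} (hx : FluidPDE.cylRadius x ≠ 0) : ‖FluidPDE.eTheta x‖ = 1 := by
  rw [FluidPDE.eTheta, norm_smul, norm_toLp_angular, norm_inv, Real.norm_eq_abs,
    abs_of_nonneg (FluidPDE.cylRadius_nonneg x), inv_mul_cancel₀ hx]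

/-- The **angular vorticity** `ω^θ(x) = ⟪ω(x), e_θ(x)⟫`, `ω = curl u`, the `e_θ`-component of the
vorticity of a velocity field on `ℝ³` in the cylindrical frame (Chen–Hou, Part I §6, p. 53:
`ω = ω^r e_r + ω^θ e_θ + ω^z e_z`; Majda–Bertozzi §2.3.3). Chen–Hou orient `e_θ` as
`(x₂, −x₁, 0)/r`, the negative of `Literature.Analysis.FluidPDE.eTheta`, so their `ω^θ` is `−angularVorticity`;
only `|ω^θ|` and `{ω^θ = 0}` are used here. Junk value `0` on the axis (`eTheta = 0` there) and
where `u` is not differentiable (`curl = 0` there). [cite: arXiv221007191, §6 Notations p. 53] -/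
def angularVorticity (u : ℝ³ → ℝ³) (x : ℝ³) : ℝ :=
  ⟪FluidPDE.curl u x, FluidPDE.eTheta x⟫

/-- Unfolding the angular vorticity. [folklore] -/
theorem angularVorticity_apply (u : ℝ³ → ℝ³) (x : ℝ³) :
    angularVorticity u x = ⟪FluidPDE.curl u x, FluidPDE.eTheta x⟫ :=
  rfl

/-- The angular vorticity of the zero field vanishes. [folklore] -/
@[simp]
theorem angularVorticity_zero (x : ℝ³) : angularVorticity (0 : ℝ³ → ℝ³) x = 0 := by
  have h : FluidPDE.curl (0 : ℝ³ → ℝ³) x = 0 := by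
    ext i
    fin_cases i <;> simp [FluidPDE.curl]
  simp [angularVorticity, h]

/-- A component is bounded by the vector: `|ω^θ(x)| ≤ ‖ω(x)‖` (Cauchy–Schwarz and `‖e_θ‖ ≤ 1`).
This is the step `‖ω^θ‖_∞ → ∞ ⟹ ‖ω‖_∞ → ∞` of the reduction below. [folklore] -/
theorem abs_angularVorticity_le_norm_curl (u : ℝ³ → ℝ³) (x : ℝ³) :
    |angularVorticity u x| ≤ ‖FluidPDE.curl u x‖ :=
  calc |angularVorticity u x| ≤ ‖FluidPDE.curl u x‖ * ‖FluidPDE.eTheta x‖ := abs_real_inner_le_norm _ _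
    _ ≤ ‖FluidPDE.curl u x‖ * 1 := by gcongr; exact norm_eTheta_le_one x
    _ = ‖FluidPDE.curl u x‖ := mul_one _

/-- The swirl velocity is bounded by the speed: `|u^θ(x)| ≤ ‖u(x)‖`. [folklore] -/
theorem abs_swirlVelocity_le_norm (u : ℝ³ → ℝ³) (x : ℝ³) :
    |FluidPDE.swirlVelocity u x| ≤ ‖u x‖ :=
  calc |FluidPDE.swirlVelocity u x| ≤ ‖u x‖ * ‖FluidPDE.eTheta x‖ := abs_real_inner_le_norm _ _
    _ ≤ ‖u x‖ * 1 := by gcongr; exact norm_eTheta_le_one x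
    _ = ‖u x‖ := mul_one _

/-- One period `D₁ = {(r, z) : r ∈ [0, 1], |z| ≤ 1}` of Chen–Hou's closed cylinder
`[0, 1] × ℝ/(2ℤ)`, as a subset of `ℝ³` (`z = x 2`): Part I §6, p. 53, "Due to the periodicity in
`z` direction, it suffices to consider the equations in the first period `D₁`"; the finite-energy
assertion of the theorem refers to `∫_{D₁} |u|² < ∞` (CMP 2021, p. 53: "the solutions have finite
energy in `D₁`"). [cite: arXiv221007191, §6 p. 53 (D₁)] -/
def chenHouPeriodCell : Set ℝ³ :=
  {x | FluidPDE.cylRadius x ≤ 1 ∧ |x 2| ≤ 1}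

/-- Membership in the period cell. [folklore] -/
@[simp]
theorem mem_chenHouPeriodCell {x : ℝ³} :
    x ∈ chenHouPeriodCell ↔ FluidPDE.cylRadius x ≤ 1 ∧ |x 2| ≤ 1 :=
  Iff.rfl

/-- The period cell contains the closure-of-cylinder slice: it lies in the closed cylinder
`{r ≤ 1}`. [folklore] -/
theorem chenHouPeriodCell_subset : chenHouPeriodCell ⊆ {x : ℝ³ | FluidPDE.cylRadius x ≤ 1} :=
  fun _ hx => hx.1

/-! ### The theorem as printed, and the reduction -/

/-- **Chen–Hou blow-up theorem for smooth axisymmetric Euler flows with boundary, as printed**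
(Part I, §1 second theorem = "Theorem 2", p. 3, precise form "Theorem 4" = `thm:euler`, §6.1
p. 54, proof §6.5 p. 66; completed by the computer-assisted Part II `[ChenHou2023RigorousNumerics]`;
published summary `[ChenHou2025]`, Theorem 1). In the cylinder `{r < 1} ⊆ ℝ³`, `2`-periodic in
the axial variable `z` (`𝕋 = ℝ/(2ℤ)`), with the no-flow condition `u · e_r = 0` on the solid
boundary `{r = 1}`: there are a smooth axisymmetric `2`-periodic velocity field `u₀` on `ℝ³`,
tangential on `{r = 1}`, whose swirl velocity `u₀^θ` and angular vorticity `ω₀^θ` are supported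
away from the symmetry axis (vanish on `{r < r₀}` for some `r₀ > 0`) and which has finite energy
on the period cell `D₁ = {r ≤ 1, |z| ≤ 1}`, and a finite time `T > 0`, such that the
incompressible Euler equations (`f = 0`) in the cylinder with the slip condition have a classical
solution `(u, p)` on `[0, T)` with `u(0) = u₀`, smooth up to the boundary, axisymmetric and
`2`-periodic for every `t < T`, whose angular vorticity blows up in the cylinder as `t ↑ T`:
`limsup_{t ↑ T} ‖ω^θ(t)‖_{L^∞({r<1})} = ∞`. Not formalised: "nearly self-similar", "stable"
(closeness to the numerical profile), the parity of the data in `z`. See the module docstring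
for the proof architecture and the faithfulness notes; `chen_hou_blowup` is the corollary
`chen_hou_blowup_of_chenHou2022`. [cite: arXiv221007191, §1 Theorem 2 (p. 3) and §6.1 Theorem 4 thm:euler (p. 54)]
[cite: ChenHou2023RigorousNumerics, §1 Theorem 2] [cite: ChenHou2025, Theorem 1] -/
def ChenHou2022_axisymmetricEulerBlowup : Prop :=
  ∃ u₀ : ℝ³ → ℝ³,
    ContDiff ℝ ∞ u₀ ∧ FluidPDE.IsAxisymmetric u₀ ∧ FluidPDE.IsAxiallyPeriodic 2 u₀ ∧
    (∀ x ∈ frontier (FluidPDE.unitCylinder : Set ℝ³), ⟪u₀ x, FluidPDE.eR x⟫ = 0) ∧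
    (∃ r₀ : ℝ, 0 < r₀ ∧ ∀ x : ℝ³, FluidPDE.cylRadius x < r₀ →
      FluidPDE.swirlVelocity u₀ x = 0 ∧ angularVorticity u₀ x = 0) ∧
    (∫⁻ x in chenHouPeriodCell, ‖u₀ x‖ₑ ^ 2) < (∞ : ℝ≥0∞) ∧
    ∃ T : ℝ, 0 < T ∧ ∃ (u : ℝ → ℝ³ → ℝ³) (p : ℝ → ℝ³ → ℝ),
      FluidPDE.IsClassicalEulerOnDomain (Ico 0 T) FluidPDE.unitCylinder FluidPDE.eR 0 u p ∧
      u 0 = u₀ ∧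
      (∀ t ∈ Ico 0 T, ContDiffOn ℝ ∞ (u t) (closure (FluidPDE.unitCylinder : Set ℝ³)) ∧
        FluidPDE.IsAxisymmetric (u t) ∧ FluidPDE.IsAxiallyPeriodic 2 (u t)) ∧
      (∀ M : ℝ, ∃ᶠ t in 𝓝[<] T, ∃ x ∈ (FluidPDE.unitCylinder : Set ℝ³),
        M < |angularVorticity (u t) x|)

/-- Blow-up of the angular vorticity inside a domain implies blow-up of the full vorticity there
(`|ω^θ| ≤ ‖ω‖`), in the accepted form `NS.VorticityBlowsUpOnAt`. [folklore] -/
theorem vorticityBlowsUpOnAt_of_angularVorticity {Ω : Set ℝ³} {u : ℝ → ℝ³ → ℝ³} {T : ℝ}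
    (h : ∀ M : ℝ, ∃ᶠ t in 𝓝[<] T, ∃ x ∈ Ω, M < |angularVorticity (u t) x|) :
    VorticityBlowsUpOnAt Ω u T := fun M =>
  (h M).mono fun _ ⟨x, hx, hM⟩ => ⟨x, hx, hM.trans_le (abs_angularVorticity_le_norm_curl _ _)⟩

/-- **`chen_hou_blowup` is a corollary of the printed theorem**: take the axial period `L := 2`,
forget the support, energy and parity information on the datum, and pass from the angular
vorticity to the full vorticity by `|ω^θ| ≤ ‖ω‖`. This records the (only) dependency of
**ns.S29 (ii)** in the decomposition; the fact `ChenHou2022_axisymmetricEulerBlowup` itself is a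
computer-assisted theorem whose core is not statable without the numerical profile (module
docstring, item 3). [cite: arXiv221007191, §1 Theorem 2 (p. 3)] -/
theorem chen_hou_blowup_of_chenHou2022 (h : ChenHou2022_axisymmetricEulerBlowup) :
    chen_hou_blowup := by
  obtain ⟨u₀, hsm, hax, hper, hslip, -, -, T, hT, u, p, hsol, h0, hslice, hblow⟩ := h
  exact ⟨2, two_pos, u₀, hsm, hax, hper, hslip, T, hT, u, p, hsol, h0, hslice,
    vorticityBlowsUpOnAt_of_angularVorticity hblow⟩

end Literature.Analysis.FluidPDE
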